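import Summits.SmoothPoincare4.SmoothPoincare4.Theses.EntropyRung
import Summits.SmoothPoincare4.SmoothPoincare4.Theorems.EntropyRungSubcylindricalExistenceSetIntegralFlatChart
import Summits.SmoothPoincare4.SmoothPoincare4.Theorems.EntropyRungSubcylindricalExistenceGluingCutoffBound
import HarnessLib

/-!
# The `ρ⁻⁴`-volume of a chart annulus in a flat chart: `∫_{a ≤ ρ ≤ b} ρ⁻⁴ dV_g = 2π² log(b/a)`
(crux stmt-SmoothPoincare4-10871 `EntropyRung.SubcylindricalExistence`, line
`fat-conical-core-avr-logsobolev`, aux helper `helper_cutoffFamily_zoneIntegral` for the stub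
`helper_cutoffFamily` (H-cut) of lead c4's skeleton)

For a smooth Riemannian metric `g` on a smooth `4`-manifold `M` of the summit binder, a point `p`
with chart `φ = extChartAt (𝓡 4) p`, `y₀ = φ p`, and a closed ball `closedBall y₀ r ⊆ φ.target`
on which `φ⁻¹` is a `g`-isometry, the annulus `Z = {x ∈ φ.source | a ≤ ‖φ x − y₀‖ ≤ b}`
(`0 < a ≤ b ≤ r`) has

  `∫_Z ‖φ x − y₀‖⁻⁴ dV_g(x) = ∫_{a ≤ ‖y − y₀‖ ≤ b} ‖y − y₀‖⁻⁴ dy = 2π² log(b/a)`: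

the chart formula `∫_{φ.source} G(φ x) dV_g = ∫_{φ.target} √det(g_{ij}) • G`
(`setIntegral_extChartAt_comp`, Chavel 2006, (III.3.6)) for `G = 𝟙_A ‖· − y₀‖⁻⁴`, the density
being `1` on the flat ball (`SetIntegralFlatChart.sqrt_det_chartGramMatrix_eq_one_of_flat`), and
polar coordinates in `ℝ⁴` (`GluingCutoffBound.integral_annulus_inv_pow_four`). Everything is
proved; no definition, no named fact.

References: I. Chavel, *Riemannian Geometry: A Modern Introduction*, 2nd ed. (2006), §III.3,
(III.3.5)–(III.3.6) [Chavel2006].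
-/

noncomputable section

-- the registered namespace `Summit.SmoothPoincare4.SmoothPoincare4.Theorems` repeats a component
set_option linter.dupNamespace false

open scoped Manifold ContDiff Topology RealInnerProductSpace
open Set Filter MeasureTheory
open Literature.Geometry.Lorentzian Literature.Geometry.Riemannian

namespace Summit.SmoothPoincare4.SmoothPoincare4.Theorems

namespace HelperCutoffFamilyZoneAux

/-- The Euclidean annulus integral centred at `y₀`:
`∫ 𝟙_{a ≤ ‖y − y₀‖ ≤ b} ‖y − y₀‖⁻⁴ dy = 2π² log(b/a)` (`0 < a ≤ b`). [folklore] -/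
theorem integral_annulus_indicator (y₀ : EuclideanSpace ℝ (Fin 4)) {a b : ℝ} (ha : 0 < a)
    (hab : a ≤ b) :
    ∫ y : EuclideanSpace ℝ (Fin 4),
        {y : EuclideanSpace ℝ (Fin 4) | a ≤ ‖y - y₀‖ ∧ ‖y - y₀‖ ≤ b}.indicator
          (fun y ↦ (‖y - y₀‖ ^ 4)⁻¹) y = 2 * Real.pi ^ 2 * Real.log (b / a) := by
  have hpt : ∀ y : EuclideanSpace ℝ (Fin 4),
      {y : EuclideanSpace ℝ (Fin 4) | a ≤ ‖y - y₀‖ ∧ ‖y - y₀‖ ≤ b}.indicator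
          (fun y ↦ (‖y - y₀‖ ^ 4)⁻¹) y =
        (Icc a b).indicator (fun t : ℝ ↦ (t ^ 4)⁻¹) ‖y - y₀‖ := by
    intro y
    by_cases hy : a ≤ ‖y - y₀‖ ∧ ‖y - y₀‖ ≤ b
    · rw [indicator_of_mem
          (s := {z : EuclideanSpace ℝ (Fin 4) | a ≤ ‖z - y₀‖ ∧ ‖z - y₀‖ ≤ b}) hy,
        indicator_of_mem (show ‖y - y₀‖ ∈ Icc a b from hy)]
    · rw [indicator_of_notMem
          (s := {z : EuclideanSpace ℝ (Fin 4) | a ≤ ‖z - y₀‖ ∧ ‖z - y₀‖ ≤ b}) hy,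
        indicator_of_notMem (show ‖y - y₀‖ ∉ Icc a b from hy)]
  simp_rw [hpt]
  rw [integral_sub_right_eq_self
    (fun z : EuclideanSpace ℝ (Fin 4) ↦ (Icc a b).indicator (fun t : ℝ ↦ (t ^ 4)⁻¹) ‖z‖) y₀]
  exact GluingCutoffBound.integral_annulus_inv_pow_four ha hab

variable {M : Type*} [TopologicalSpace M] [ChartedSpace (EuclideanSpace ℝ (Fin 4)) M]
  [IsManifold (𝓡 4) ∞ M] [T3Space M] [MeasurableSpace M] [BorelSpace M]
  (g : PseudoRiemannianMetric (𝓡 4) ∞ (EuclideanSpace ℝ (Fin 4)) (TangentSpace (𝓡 4) : M → Type _))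
  (hg : g.IsRiemannian) (p : M)

/-- **The `ρ⁻⁴`-volume of a chart annulus** (workhorse, named hypotheses):
`∫_{x ∈ φ.source, a ≤ ‖φ x − y₀‖ ≤ b} ‖φ x − y₀‖⁻⁴ dV_g = 2π² log(b/a)` for `0 < a ≤ b ≤ r`, `g` flat
in the chart on `closedBall y₀ r ⊆ φ.target`. [cite: Chavel2006, §III.3 (III.3.6)] -/
theorem setIntegral_annulus {r a b : ℝ}
    (hB : Metric.closedBall (extChartAt (𝓡 4) p p) r ⊆ (extChartAt (𝓡 4) p).target)
    (hflat : ∀ y ∈ Metric.closedBall (extChartAt (𝓡 4) p p) r, ∀ X W : EuclideanSpace ℝ (Fin 4),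
        g.val ((extChartAt (𝓡 4) p).symm y)
          (mfderiv 𝓘(ℝ, EuclideanSpace ℝ (Fin 4)) (𝓡 4) (extChartAt (𝓡 4) p).symm y X)
          (mfderiv 𝓘(ℝ, EuclideanSpace ℝ (Fin 4)) (𝓡 4) (extChartAt (𝓡 4) p).symm y W) = ⟪X, W⟫)
    (ha : 0 < a) (hab : a ≤ b) (hbr : b ≤ r) :
    ∫ x in {x | x ∈ (extChartAt (𝓡 4) p).source ∧
        a ≤ ‖extChartAt (𝓡 4) p x - extChartAt (𝓡 4) p p‖ ∧
        ‖extChartAt (𝓡 4) p x - extChartAt (𝓡 4) p p‖ ≤ b},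
      (‖extChartAt (𝓡 4) p x - extChartAt (𝓡 4) p p‖ ^ 4)⁻¹
      ∂(riemannianMeasure (g.toContMDiffRiemannianMetric hg)) = 2 * Real.pi ^ 2 * Real.log (b / a) := by
  set φ := extChartAt (𝓡 4) p with hφ
  set y₀ := φ p with hy₀
  set G₀ := g.toContMDiffRiemannianMetric hg with hG₀
  set μ : Measure M := riemannianMeasure G₀ with hμ
  set A : Set (EuclideanSpace ℝ (Fin 4)) := {y | a ≤ ‖y - y₀‖ ∧ ‖y - y₀‖ ≤ b} with hA
  have hAB : A ⊆ Metric.closedBall y₀ r := fun y hy ↦ mem_closedBall_iff_norm.2 (hy.2.trans hbr)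
  have hAc : IsClosed A :=
    (isClosed_le continuous_const (continuous_id.sub continuous_const).norm).inter
      (isClosed_le (continuous_id.sub continuous_const).norm continuous_const)
  have hAm : MeasurableSet A := hAc.measurableSet
  have hsrc : MeasurableSet φ.source := (isOpen_extChartAt_source p).measurableSet
  have hSm : MeasurableSet (φ.source ∩ φ ⁻¹' A) :=
    measurableSet_source_inter_preimage_extChartAt (I := 𝓡 4) p hAm
  have hS : {x | x ∈ φ.source ∧ a ≤ ‖φ x - y₀‖ ∧ ‖φ x - y₀‖ ≤ b} =
      φ.source ∩ (φ.source ∩ φ ⁻¹' A) := by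
    rw [← inter_assoc, inter_self]
    rfl
  -- the chart representative `G = 𝟙_A ‖· − y₀‖⁻⁴`
  set G : EuclideanSpace ℝ (Fin 4) → ℝ := A.indicator (fun y ↦ (‖y - y₀‖ ^ 4)⁻¹) with hGdef
  have hmeas : Measurable (fun y : EuclideanSpace ℝ (Fin 4) ↦ (‖y - y₀‖ ^ 4)⁻¹) := by fun_prop
  have hGm : AEStronglyMeasurable G
      ((volume : Measure (EuclideanSpace ℝ (Fin 4))).restrict φ.target) :=
    (hmeas.indicator hAm).aestronglyMeasurable
  -- the density is `1` on `A`
  have hdens : ∀ y ∈ A, Real.sqrt (chartGramMatrix G₀ p y).det = 1 := fun y hy ↦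
    SetIntegralFlatChart.sqrt_det_chartGramMatrix_eq_one_of_flat g hg p (hflat y (hAB hy))
  calc ∫ x in {x | x ∈ φ.source ∧ a ≤ ‖φ x - y₀‖ ∧ ‖φ x - y₀‖ ≤ b}, (‖φ x - y₀‖ ^ 4)⁻¹ ∂μ
      = ∫ x in φ.source ∩ (φ.source ∩ φ ⁻¹' A), (‖φ x - y₀‖ ^ 4)⁻¹ ∂μ := by rw [hS]
    _ = ∫ x in φ.source, (φ.source ∩ φ ⁻¹' A).indicator (fun x ↦ (‖φ x - y₀‖ ^ 4)⁻¹) x ∂μ :=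
        (setIntegral_indicator hSm).symm
    _ = ∫ x in φ.source, G (φ x) ∂μ := by
        refine setIntegral_congr_fun hsrc (fun x hx ↦ ?_)
        by_cases hxA : φ x ∈ A
        · have h1 : x ∈ φ.source ∩ φ ⁻¹' A := ⟨hx, hxA⟩
          rw [indicator_of_mem h1, hGdef, indicator_of_mem hxA]
        · have h1 : x ∉ φ.source ∩ φ ⁻¹' A := fun h ↦ hxA h.2
          rw [indicator_of_notMem h1, hGdef, indicator_of_notMem hxA]
    _ = ∫ y in φ.target, Real.sqrt (chartGramMatrix G₀ p y).det • G y :=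
        setIntegral_extChartAt_comp G₀ p hGm
    _ = ∫ y in φ.target,
          A.indicator (fun y ↦ Real.sqrt (chartGramMatrix G₀ p y).det • (‖y - y₀‖ ^ 4)⁻¹) y := by
        refine setIntegral_congr_fun (measurableSet_extChartAt_target (I := 𝓡 4) p) (fun y _ ↦ ?_)
        rw [hGdef, indicator_smul_apply]
    _ = ∫ y in φ.target ∩ A, Real.sqrt (chartGramMatrix G₀ p y).det • (‖y - y₀‖ ^ 4)⁻¹ :=
        setIntegral_indicator hAm
    _ = ∫ y in A, Real.sqrt (chartGramMatrix G₀ p y).det • (‖y - y₀‖ ^ 4)⁻¹ := by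
        rw [inter_eq_right.2 (hAB.trans hB)]
    _ = ∫ y in A, (‖y - y₀‖ ^ 4)⁻¹ := by
        refine setIntegral_congr_fun hAm (fun y hy ↦ ?_)
        rw [hdens y hy, one_smul]
    _ = ∫ y, A.indicator (fun y ↦ (‖y - y₀‖ ^ 4)⁻¹) y := (integral_indicator hAm).symm
    _ = 2 * Real.pi ^ 2 * Real.log (b / a) := integral_annulus_indicator y₀ ha hab

end HelperCutoffFamilyZoneAux

/-- **The `ρ⁻⁴`-volume of a chart annulus in a flat chart** (aux helper
`helper_cutoffFamily_zoneIntegral` of the stub `helper_cutoffFamily`, line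
`fat-conical-core-avr-logsobolev`; ∀-form of `HelperCutoffFamilyZoneAux.setIntegral_annulus`): for
`g` Euclidean in the chart `φ = extChartAt (𝓡 4) p` on `closedBall (φ p) r ⊆ φ.target` and
`0 < a ≤ b ≤ r`, `∫_{x ∈ φ.source, a ≤ ‖φ x − φ p‖ ≤ b} ‖φ x − φ p‖⁻⁴ dV_g = 2π² log(b/a)`. The
instance `[g.HasLeviCivita]` is not used. [cite: Chavel2006, §III.3 (III.3.6)] -/
theorem helper_cutoffFamily_zoneIntegral :
    ∀ (M : Type) [TopologicalSpace M] [T2Space M] [SecondCountableTopology M]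
      [ChartedSpace (EuclideanSpace ℝ (Fin 4)) M] [IsManifold (𝓡 4) ∞ M] [CompactSpace M]
      [T3Space M] [MeasurableSpace M] [BorelSpace M]
      (g : PseudoRiemannianMetric (𝓡 4) ∞ (EuclideanSpace ℝ (Fin 4)) (TangentSpace (𝓡 4) : M → Type _))
      [g.HasLeviCivita] (hg : g.IsRiemannian) (p : M) (r : ℝ),
      (Metric.closedBall (extChartAt (𝓡 4) p p) r ⊆ (extChartAt (𝓡 4) p).target ∧
        ∀ y ∈ Metric.closedBall (extChartAt (𝓡 4) p p) r, ∀ X W : EuclideanSpace ℝ (Fin 4),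
          g.val ((extChartAt (𝓡 4) p).symm y)
            (mfderiv 𝓘(ℝ, EuclideanSpace ℝ (Fin 4)) (𝓡 4) (extChartAt (𝓡 4) p).symm y X)
            (mfderiv 𝓘(ℝ, EuclideanSpace ℝ (Fin 4)) (𝓡 4) (extChartAt (𝓡 4) p).symm y W) = ⟪X, W⟫) →
      ∀ a b : ℝ, 0 < a → a ≤ b → b ≤ r →
        ∫ x in {x | x ∈ (extChartAt (𝓡 4) p).source ∧
            a ≤ ‖extChartAt (𝓡 4) p x - extChartAt (𝓡 4) p p‖ ∧
            ‖extChartAt (𝓡 4) p x - extChartAt (𝓡 4) p p‖ ≤ b},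
          (‖extChartAt (𝓡 4) p x - extChartAt (𝓡 4) p p‖ ^ 4)⁻¹
          ∂(riemannianMeasure (g.toContMDiffRiemannianMetric hg)) =
        2 * Real.pi ^ 2 * Real.log (b / a) := by
  intro M _ _ _ _ _ _ _ _ _ g _ hg p r hflat a b ha hab hbr
  exact HelperCutoffFamilyZoneAux.setIntegral_annulus g hg p hflat.1 hflat.2 ha hab hbr

end Summit.SmoothPoincare4.SmoothPoincare4.Theorems

end
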